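import Literature.AlgebraicGeometry.ComplexMultiplication.AndreProductFormBiproduct
import Literature.AlgebraicGeometry.HodgeTheory.WeilTypeHodgeRing
import Literature.AlgebraicGeometry.ComplexMultiplication.CMWeilSectionSqrt
import Literature.AlgebraicGeometry.ComplexMultiplication.AndreRiemannBiproducts
import Literature.AlgebraicGeometry.HodgeTheory.AbelianLowDimensionWeilReductionProofs
import Literature.AlgebraicGeometry.ComplexMultiplication.SimpleIffPrimitiveCMType
import Literature.AlgebraicGeometry.Motives.AbelianVarietySimpleOfIsogeny
import Literature.AlgebraicGeometry.Milne1999.CMSimpleIsogenousCMTyped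
import Literature.AlgebraicGeometry.ComplexMultiplication.CMWeilSectionDichotomyFive
import Literature.AlgebraicGeometry.ComplexMultiplication.CMWeightPullbackSubproduct
import HarnessLib

/-!
# Weil sections of CM-product abelian varieties: the Weil-type endomorphism of a Weil section, domination of CM products by
# biproducts of (simple) CM realisations, and Pohlmann pair rigidity for simple realisations

Bookkeeping around Moonen–Zarhin 1999 Thms. 0.1–0.2 for products `B = ⨁_i A_i` of CM realisations `(A_i, ι_i, θ_i)` of CM
types `Φ_i` of CM fields `K_i`: (i) a WEIL SECTION `S ∈ pohlmannSetsAlg Φ m` (a Galois-balanced `2m`-subset of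
`⊔_i Hom(K_i, ℂ)` meeting every conjugate pair once, read through square roots `a_i ∈ 𝓞_{K_i}`, `a_i² = -d`) makes
`(B, φ_S = ⊕_i ι_i(a_i))` a pair of WEIL TYPE and puts the weight line `H^{2m}(B)_S` inside the complex span of the rational
`(m,m)` Weil classes of `φ_S` (van Geemen 1994, 4.9–4.10, 5.2; the conclusion shape of Thm. 0.1 for CM-product fourfolds,
`moonenZarhin_codimTwo_biproduct_cm`); (ii) every finite product of (simple) CM-typed abelian varieties is dominated, up to a
non-zero integer, by a biproduct of (simple) CM realisations of the same total dimension; (iii) for SIMPLE realisations a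
Galois-balanced pair inside one block `Hom(K_i, ℂ)` is a conjugate pair (pair rigidity), and Pohlmann's balance condition
descends along coordinate sub-products.

* Part 1 — from `CorCM/WeilFourfoldOfMarkman` (1/5 declarations; namespace
  `Literature.AlgebraicGeometry.ComplexMultiplication.WeilFourfold`): COR-CM — the Weil fourfold `B ⊞ E` of a CM
  threefold and a CM elliptic curve: Markman's theorem instantiated. Declarations: `comp_self_eq_neg_of_sq_eq_neg`.
* Part 2 — from `CorCM/WeilFourfoldOfMarkmanPlane` (1/15 declarations; namespace
  `Literature.AlgebraicGeometry.ComplexMultiplication.WeilFourfold`): COR-CM — the Weil fourfold `B ⊞ E`: Weil type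
  from the CM types, and the WHOLE Weil plane is algebraic (mod Markman). Declarations:
  `cupPowOne_mem_weilClassesPlus`.
* Part 3 — from `CorCM/CMWeilSectionEndomorphism` (2/2 declarations; namespace
  `Literature.AlgebraicGeometry.ComplexMultiplication.CMWeights`): The Weil eigen-line of a Weil section: `H^{2m}(B)_S
  ⊆ ⋀^{2m} V₊` for `φ_S = ⊕_i ι_i(a_i)`, `φ_S² = -d`. Declarations: `biproduct_map_comp_self_eq_neg`,
  `weightClassesAlg_le_weilClassesPlus_of_weilSection`.
* Part 4 — from `CorCM/CMFourfoldsOfMarkman` (1/4 declarations; namespace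
  `Literature.AlgebraicGeometry.ComplexMultiplication.CMWeights`): The Hodge conjecture for complex abelian varieties
  of CM type of dimension `≤ 4`, from Markman's theorem. Declarations: `exists_biproduct_family_of_isProductOf`.
* Part 5 — from `CorCM/CMProductFourfoldsOfMarkman` (3/9 declarations; namespace
  `Literature.AlgebraicGeometry.ComplexMultiplication.CMWeights`): Products of CM abelian varieties of total dimension
  `4`: the Hodge conjecture from Markman's theorem. Declarations: `sum_finrank_eq_two_mul_dim`,
  `isWeilType_of_weilSection`, `moonenZarhin_codimTwo_biproduct_cm`.
* Part 6 — from `CorCM/CMFivefoldsOfMarkman` (5/10 declarations; namespace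
  `Literature.AlgebraicGeometry.ComplexMultiplication.CMWeights`): The Hodge conjecture for complex abelian varieties
  of CM type of dimension `≤ 5`, from Markman's theorem. Declarations:
  `comp_mem_iff_comp_not_mem_of_isGaloisBalancedAlg_pair`, `eq_conj_smul_of_isGaloisBalancedAlg_pair_of_isSimple`,
  `exists_isProductOf_of_atoms`, `exists_isProductOf_simple_cmTyped`, `exists_simple_biproduct_family_of_isProductOf`.
* Part 7 — from `CorCM/CMProductFivefoldsOfMarkman` (2/6 declarations; namespace
  `Literature.AlgebraicGeometry.ComplexMultiplication.CMWeights`): Products of pair-rigid CM abelian varieties of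
  total dimension `5`: the Hodge conjecture from Markman's theorem. Declarations: `smul_finset_map_sigma`,
  `isGaloisBalancedAlg_comap`.

## References

* [Markman2025SurveySecant] E. Markman, *Secant sheaves and Weil classes on abelian varieties*, arXiv:2509.23403, Thm.
  1.2 and §11.5 Step 2 (as vendored in `HodgeTheory/WeilClassesFourfolds.lean`).
* [vanGeemen1994HodgeAV] B. van Geemen, LNM 1594 (1994), 4.9 (the Weil plane `E₊ ⊔ E₋`).
* [Deligne1982HodgeCycles] P. Deligne (notes by J. S. Milne), LNM 900 (1982), §4 Prop. 4.4, §5 (c).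
* [Milne2020HodgeClassesAV] J. S. Milne, *Hodge classes on abelian varieties* (2020), 1.2 (a).
* [MoonenZarhin1999LowDim] B. Moonen, Yu. Zarhin, Math. Ann. 315 (1999), Thm. 0.1 and (1.9).
* [Shimura1998] G. Shimura, *Abelian Varieties with Complex Multiplication and Modular Functions*, §5.1 Props. 3–6,
  §7.1.
* [MumfordAV1970] D. Mumford, *Abelian Varieties*, §19 Thm. 1 and p. 169.
* [DeligneMilne1982Tannakian] P. Deligne, J. S. Milne, LNM 900, Thm. 6.20.
* [GaoUllmo2025] Z. Gao, E. Ullmo, J. Inst. Math. Jussieu 25 (2025), Thm. 3.1.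
* [Gordon1999HodgeAVSurvey] B. B. Gordon, *A survey of the Hodge conjecture for abelian varieties*, 9.2.2.

Provenance: Literature home of the used declarations of the Summits-side modules listed part by part above (cells
`pub-hodge-ring2` / `pub-hodgecm2`; namespaces `Summit.HodgeConjecture.CorCM.CMWeights`,
`Summit.HodgeConjecture.CorCM.WeilFourfold` re-rooted under `Literature.AlgebraicGeometry.…` as stated), whose imports
are `Literature/` and Mathlib only for the declarations used; re-homed verbatim (proofs unchanged) so that Literature
users are served without importing `Summits/`. Lane `lit-hodgefound`, seat p20 (generation 34). Theorems only: no
definition, no named fact, no `sorry`; axioms `propext`, `Classical.choice`, `Quot.sound`.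
-/

/-! ## Part 1: WeilFourfoldOfMarkman -/

noncomputable section

namespace Literature.AlgebraicGeometry.ComplexMultiplication.WeilFourfold

open _root_.CategoryTheory _root_.CategoryTheory.Limits NumberField
open Literature.AlgebraicGeometry.Motives Literature.AlgebraicGeometry.HodgeTheory
open Literature.AlgebraicTopology.SingularHomology

/-- `ι(δ) ∘ ι(δ) = -d` for a ring action `ι` and `δ² = -d`. [cite: MoonenZarhin1999LowDim, §1 (1.4), (1.9)] -/
theorem comp_self_eq_neg_of_sq_eq_neg {A : AbelianVariety ℂ} {R : Type*} [CommRing R] (ι : R →+* End A)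
    {δ : R} {d : ℕ} (hδ : δ ^ 2 = -(d : R)) : ι δ ≫ ι δ = -(d • 𝟙 A) := by
  rw [← End.mul_def, ← map_mul, ← pow_two, hδ, map_neg, map_natCast, ← Nat.smul_one_eq_cast]
  rfl

end Literature.AlgebraicGeometry.ComplexMultiplication.WeilFourfold

end

/-! ## Part 2: WeilFourfoldOfMarkmanPlane -/

noncomputable section

namespace Literature.AlgebraicGeometry.ComplexMultiplication.WeilFourfold

open _root_.CategoryTheory _root_.CategoryTheory.Limits NumberField
open Literature.AlgebraicGeometry Literature.AlgebraicGeometry.Motives Literature.AlgebraicGeometry.HodgeTheory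
open Literature.AlgebraicTopology.SingularHomology
open Literature.NumberTheory.Automorphic.PicardCM (eigenline)

/-! ## §1 A non-zero `(m,m)` Weil class from `2m` eigenvectors -/

section Eigenvectors

variable {Y : AbelianVariety ℂ} (φ : Y ⟶ Y) {d : ℕ}

/-- **`v₁ ⌣ ⋯ ⌣ v_{2m} ∈ E₊`** for `i√d`-eigenvectors `vᵢ` of `φ^*` on `H¹(Y)`: `(x·𝟙 + y·φ)^*` acts on each `vᵢ`
by `x + y·i√d` (`complexBetti_map_nsmul_id_add_nsmul_one_of_mem_eigenspace`), hence on the cup product by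
`(x + y·i√d)^{2m}` (naturality `complexBetti_map_cupPowOne` and multilinearity).  Van Geemen: "`⋀^{2n} W`" is the
`+`-eigenline. [cite: vanGeemen1994HodgeAV, 4.9 and proof of Thm. 6.12] -/
theorem cupPowOne_mem_weilClassesPlus {m : ℕ} (w : Fin (2 * m) → complexBetti Y.X 1)
    (hw : ∀ j, w j ∈ Module.End.eigenspace (complexBetti.map φ.hom.hom.hom 1).hom
      (Complex.I * (Real.sqrt d : ℂ))) :
    cupPowOne ℂ (ComplexPoints Y.X) (2 * m) w ∈ weilClassesPlus Y φ m d := by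
  rw [mem_weilClassesPlus_iff]
  intro x y
  change complexBetti.map (x • 𝟙 Y + y • φ).hom.hom.hom (2 * m) (cupPowOne ℂ (ComplexPoints Y.X) (2 * m) w) = _
  rw [complexBetti_map_cupPowOne]
  have e : (fun j => complexBetti.map (x • 𝟙 Y + y • φ).hom.hom.hom 1 (w j)) =
      fun j => ((x : ℂ) + (y : ℂ) * (Complex.I * (Real.sqrt d : ℂ))) • w j := by
    funext j
    exact complexBetti_map_nsmul_id_add_nsmul_one_of_mem_eigenspace (hw j) x y
  rw [e, MultilinearMap.map_smul_univ, Finset.prod_const, Finset.card_univ, Fintype.card_fin, ← mul_assoc]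

end Eigenvectors

end Literature.AlgebraicGeometry.ComplexMultiplication.WeilFourfold
end

/-! ## Part 3: CMWeilSectionEndomorphism -/

noncomputable section

open _root_.CategoryTheory _root_.CategoryTheory.Limits NumberField

namespace Literature.AlgebraicGeometry.ComplexMultiplication.CMWeights

open Literature.AlgebraicGeometry.Motives (AbelianVariety CMType IsSmoothProjective)
open Literature.AlgebraicGeometry.HodgeTheory
open Literature.AlgebraicGeometry.Pohlmann1968
open Literature.AlgebraicGeometry.ComplexMultiplication (IsCMTypeRealisation)
open Literature.AlgebraicTopology.SingularHomology
open Literature.NumberTheory.ComplexMultiplication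

open scoped Classical Pointwise

/-! ### §3 The endomorphism `φ_S = ⊕_i ι_i(a_i)` and the Weil eigen-line of the weight `S` -/

section Geometry

variable {n : ℕ} {K : Fin n → Type} [∀ i, Field (K i)] [∀ i, NumberField (K i)]
variable {A : Fin n → AbelianVariety ℂ} {Φ : ∀ i, CMType (K i)} {ι : ∀ i, 𝓞 (K i) →+* End (A i)}
  {θ : ∀ i, K i →+* Module.End ℂ (complexBetti (A i).X 1)}

omit [∀ i, NumberField (K i)] in
/-- `(⊕_i ι_i(a_i))² = -d` on `⨁_i A_i` when `a_i² = -d` in every `𝓞_{K_i}` (componentwise, `biproduct.hom_ext`).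
 [cite: vanGeemen1994HodgeAV, 4.9 and proof of Thm. 6.12] -/
theorem biproduct_map_comp_self_eq_neg (a : ∀ i, 𝓞 (K i)) {d : ℕ} (ha : ∀ i, a i * a i = -(d : 𝓞 (K i))) :
    (biproduct.map fun i => ι i (a i)) ≫ (biproduct.map fun i => ι i (a i)) = -(d • 𝟙 (⨁ A)) := by
  apply biproduct.hom_ext
  intro j
  have hj : ι j (a j) ≫ ι j (a j) = -(d • 𝟙 (A j)) :=
    WeilFourfold.comp_self_eq_neg_of_sq_eq_neg (ι j) (by rw [sq]; exact ha j)
  rw [Category.assoc, biproduct.map_π, biproduct.map_π_assoc, hj]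
  simp

/-- **The Weil eigen-line of a Weil section.**  Let `(A_i, ι_i, θ_i)` realise CM types `Φ_i` of CM fields `K_i`
on `H¹`, `B = ⨁_i A_i`, and let `S ∈ pohlmannSetsAlg Φ m` (a balanced `2m`-subset of `⊔_i Hom(K_i, ℂ)`) be a WEIL
SECTION (no conjugate pair inside, every conjugate pair met, `τ • S ∈ {S, ρ • S}` for all `τ ∈ Aut(ℂ)`).  Then for the
`d ≥ 1` and `a_i ∈ 𝓞_{K_i}` of `exists_sqrt_neg_of_weilSection` (`a_i² = -d`), the endomorphism
`φ_S = ⊕_i ι_i(a_i)` of `B` satisfies `φ_S² = -d`, and the weight line `H^{2m}(B)_S` (`weightClassesAlg A ι (2m) S`,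
the line `ℂ · w_S` of the cup monomial of the eigenvectors indexed by `S`, Milne 1.2 (a)) lies in the `+`-Weil
eigen-line `weilClassesPlus B φ_S m d` (`(x + yφ_S)^* = (x + y i√d)^{2m}` on it: every `w_{(i,s)}`, `(i,s) ∈ S`, is an
`i√d`-eigenvector of `φ_S^*`, van Geemen 4.9 «`⋀^{2n} W`»), and contains a NON-ZERO class of Hodge type `(m, m)`
(`|S ∩ Φ| = m = |S ∖ Φ|`).  [cite: vanGeemen1994HodgeAV, 4.9 and proof of Thm. 6.12]
[cite: Milne2020HodgeClassesAV, 1.2 (a)] -/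
theorem weightClassesAlg_le_weilClassesPlus_of_weilSection
    (hA : ∀ i, IsCMTypeRealisation (Φ i) (A i) (ι i) (θ i)) {m : ℕ} {S : Finset ((i : Fin n) × (K i →+* ℂ))}
    (hS : S ∈ pohlmannSetsAlg Φ m) (hS0 : S.Nonempty) (hsec : ∀ x ∈ S, (starRingAut : ℂ ≃+* ℂ) • x ∉ S)
    (hfull : ∀ x : (i : Fin n) × (K i →+* ℂ), x ∈ S ∨ (starRingAut : ℂ ≃+* ℂ) • x ∈ S)
    (hW : ∀ τ : ℂ ≃+* ℂ, τ • S = S ∨ τ • S = (starRingAut : ℂ ≃+* ℂ) • S) :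
    ∃ (d : ℕ) (a : ∀ i, 𝓞 (K i)), 0 < d ∧ (∀ i, a i * a i = -(d : 𝓞 (K i))) ∧
      (biproduct.map fun i => ι i (a i)) ≫ (biproduct.map fun i => ι i (a i)) = -(d • 𝟙 (⨁ A)) ∧
      weightClassesAlg A ι (2 * m) S ≤ weilClassesPlus (⨁ A) (biproduct.map fun i => ι i (a i)) m d ∧
      ∃ c ∈ weightClassesAlg A ι (2 * m) S, c ≠ 0 ∧ IsOfHodgeType (⨁ A).dim (⨁ A).X (2 * m) m m c := by
  obtain ⟨d, a, hd, hval, -, hsq⟩ := exists_sqrt_neg_of_weilSection hS0 hsec hfull hW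
  refine ⟨d, a, hd, hsq, biproduct_map_comp_self_eq_neg a hsq, ?_⟩
  letI : LinearOrder ((i : Fin n) × (K i →+* ℂ)) :=
    LinearOrder.lift' (Fintype.equivFin _) (Fintype.equivFin _).injective
  obtain ⟨w, hw, hw10, hw01⟩ := exists_eigenbasis_biproduct hA
  obtain ⟨b, hb⟩ := exists_monomialBasis w (2 * m)
  have hb' : ∀ s, b s = cupMonomial w (2 * m) s := fun s => hb s
  let u : Set.powersetCard ((i : Fin n) × (K i →+* ℂ)) (2 * m) := Set.powersetCard.ofCard hS.1
  have hline : weightClassesAlg A ι (2 * m) S = ℂ ∙ b u := weightClassesAlg_eq_span_singleton hw hb' u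
  -- every `w_x`, `x ∈ S`, is an `i√d`-eigenvector of `φ_S^*`
  have heig : ∀ j : Fin (2 * m), w (Set.powersetCard.ofFinEmbEquiv.symm u j) ∈
      Module.End.eigenspace (complexBetti.map (biproduct.map fun i => ι i (a i)).hom.hom.hom 1).hom
        (Complex.I * (Real.sqrt d : ℂ)) := by
    intro j
    have hmem : Set.powersetCard.ofFinEmbEquiv.symm u j ∈ S :=
      (Set.powersetCard.mem_range_ofFinEmbEquiv_symm_iff_mem u _).1 ⟨j, rfl⟩
    rw [Module.End.mem_eigenspace_iff]
    change complexBetti.map (biproduct.map fun i => ι i (a i)).hom.hom.hom 1 (w _) = _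
    rw [hw a, hval _ hmem]
  have hplus : b u ∈ weilClassesPlus (⨁ A) (biproduct.map fun i => ι i (a i)) m d := by
    rw [hb u]
    exact WeilFourfold.cupPowOne_mem_weilClassesPlus _ _ heig
  refine ⟨?_, b u, ?_, b.ne_zero u, ?_⟩
  · rw [hline]
    exact (Submodule.span_singleton_le_iff_mem _ _).2 hplus
  · rw [hline]; exact Submodule.mem_span_singleton_self _
  · -- Hodge type `(m, m)`: `|S ∩ Φ| = m = |S ∖ Φ|`
    have hX : IsSmoothProjective (⨁ A).dim (⨁ A).X := AbelianVariety.isSmoothProjective_holds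
    have h := isOfHodgeType_monomial hX hb (fun x => x.2 ∈ (Φ x.1).1) hw10 hw01 u
    have h1 := hS.2 (RingEquiv.refl ℂ)
    have hcomp : ∀ x : (i : Fin n) × (K i →+* ℂ), ((RingEquiv.refl ℂ : ℂ ≃+* ℂ) : ℂ →+* ℂ).comp x.2 = x.2 :=
      fun x => RingHom.ext fun _ => rfl
    simp only [hcomp] at h1
    have h2 := hS.2.card_eq_two_mul
    rw [hS.1] at h2
    have hP : {x | x ∈ (u : Finset ((i : Fin n) × (K i →+* ℂ))) ∧ x.2 ∈ (Φ x.1).1}.ncard = m := by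
      change {x | x ∈ S ∧ x.2 ∈ (Φ x.1).1}.ncard = m
      omega
    have hN : {x | x ∈ (u : Finset ((i : Fin n) × (K i →+* ℂ))) ∧ ¬ x.2 ∈ (Φ x.1).1}.ncard = m := by
      change {x | x ∈ S ∧ x.2 ∉ (Φ x.1).1}.ncard = m
      omega
    rw [hP, hN] at h
    exact h

end Geometry

end Literature.AlgebraicGeometry.ComplexMultiplication.CMWeights

end

/-! ## Part 4: CMFourfoldsOfMarkman -/

noncomputable section

open _root_.CategoryTheory _root_.CategoryTheory.Limits NumberField

namespace Literature.AlgebraicGeometry.ComplexMultiplication.CMWeights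

open Literature.AlgebraicGeometry.Motives Literature.AlgebraicGeometry.Motives.AbelianVariety
open Literature.AlgebraicGeometry.HodgeTheory
open Literature.AlgebraicGeometry.ComplexMultiplication (IsCMTypeRealisation)
open Literature.AlgebraicGeometry.Milne1999
open Literature.AlgebraicGeometry.ComplexMultiplication.Domination Literature.AlgebraicGeometry.ComplexMultiplication.AndreRiemann

/-! ### §1 Products of CM-typed abelian varieties as biproducts of realisations (different fields) -/

/-- **A finite product of CM-typed abelian varieties is dominated by a biproduct of CM realisations of the same total
dimension.**  For `B` with `IsProductOf IsCMTyped B` there are a finite family of CM fields `K_i`, CM types `Φ_i`,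
realisations `(C_i, ι_i, θ_i)` on `H¹`, a domination `AVDominatedBy B (⨁_i C_i)` (in fact an isomorphism), and
`dim ⨁_i C_i = dim B` — by induction along the product tree, gluing the families of the two factors
(`Domination.avDominatedBy_prod_of_biproduct`, `avDominatedBy_biproduct_reindex`) and adding dimensions
(`dim_prod`, `dim_biproduct_fin`). [cite: MumfordAV1970, §19 Thm. 1 and p. 169] -/
theorem exists_biproduct_family_of_isProductOf {B : AbelianVariety ℂ} (hB : IsProductOf IsCMTyped B) :
    ∃ (n : ℕ) (K : Fin n → Type) (_ : ∀ i, Field (K i)) (_ : ∀ i, NumberField (K i)) (_ : ∀ i, IsCMField (K i))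
      (C : Fin n → AbelianVariety ℂ) (Φ : ∀ i, CMType (K i)) (ι : ∀ i, 𝓞 (K i) →+* End (C i))
      (θ : ∀ i, K i →+* Module.End ℂ (complexBetti (C i).X 1)),
      (∀ i, IsCMTypeRealisation (Φ i) (C i) (ι i) (θ i)) ∧ AVDominatedBy B (⨁ C) ∧ (⨁ C).dim = B.dim := by
  classical
  induction hB with
  | @atom B hBt =>
    obtain ⟨Φ, B, ι, θ, h⟩ := hBt
    rename_i K _ _ _
    refine ⟨1, fun _ => K, fun _ => inferInstance, fun _ => inferInstance, fun _ => inferInstance, fun _ => B,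
      fun _ => Φ, fun _ => ι, fun _ => θ, fun _ => h, avDominatedBy_biproduct_single B, ?_⟩
    rw [dim_biproduct_fin]
    simp
  | @prod B₁ B₂ _ _ ih₁ ih₂ =>
    obtain ⟨n₁, K₁, iF₁, iN₁, iC₁, C₁, Φ₁, ι₁, θ₁, hC₁, hd₁, hdim₁⟩ := ih₁
    obtain ⟨n₂, K₂, iF₂, iN₂, iC₂, C₂, Φ₂, ι₂, θ₂, hC₂, hd₂, hdim₂⟩ := ih₂
    -- the glued family on `Fin n₁ ⊕ Fin n₂`
    let K : Fin n₁ ⊕ Fin n₂ → Type := fun j => match j with | Sum.inl j => K₁ j | Sum.inr j => K₂ j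
    letI iF : ∀ j, Field (K j) := fun j => match j with | Sum.inl j => iF₁ j | Sum.inr j => iF₂ j
    letI iN : ∀ j, NumberField (K j) := fun j => match j with | Sum.inl j => iN₁ j | Sum.inr j => iN₂ j
    have iC : ∀ j, IsCMField (K j) := fun j => match j with | Sum.inl j => iC₁ j | Sum.inr j => iC₂ j
    let Φ : ∀ j, CMType (K j) := fun j => match j with | Sum.inl j => Φ₁ j | Sum.inr j => Φ₂ j
    let ι : ∀ j, 𝓞 (K j) →+* End (sumFam C₁ C₂ j) := fun j => match j with | Sum.inl j => ι₁ j | Sum.inr j => ι₂ j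
    let θ : ∀ j, K j →+* Module.End ℂ (complexBetti (sumFam C₁ C₂ j).X 1) :=
      fun j => match j with | Sum.inl j => θ₁ j | Sum.inr j => θ₂ j
    have hC : ∀ j, IsCMTypeRealisation (Φ j) (sumFam C₁ C₂ j) (ι j) (θ j) :=
      fun j => match j with | Sum.inl j => hC₁ j | Sum.inr j => hC₂ j
    let e : Fin (n₁ + n₂) ≃ Fin n₁ ⊕ Fin n₂ := finSumFinEquiv.symm
    refine ⟨n₁ + n₂, fun i => K (e i), fun i => iF (e i), fun i => iN (e i), fun i => iC (e i),
      fun i => sumFam C₁ C₂ (e i), fun i => Φ (e i), fun i => ι (e i), fun i => θ (e i), fun i => hC (e i),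
      avDominatedBy_biproduct_reindex e (avDominatedBy_prod_of_biproduct hd₁ hd₂), ?_⟩
    -- dimensions: `Σ_{Fin (n₁+n₂)} = Σ_{inl} + Σ_{inr}`
    rw [dim_biproduct_fin, dim_prod, ← hdim₁, ← hdim₂, dim_biproduct_fin, dim_biproduct_fin]
    rw [show (∑ i : Fin (n₁ + n₂), (sumFam C₁ C₂ (e i)).dim) = ∑ j : Fin n₁ ⊕ Fin n₂, (sumFam C₁ C₂ j).dim from
      Fintype.sum_equiv e _ _ fun _ => rfl, Fintype.sum_sum_type]

end Literature.AlgebraicGeometry.ComplexMultiplication.CMWeights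

end

/-! ## Part 5: CMProductFourfoldsOfMarkman -/

noncomputable section

open _root_.CategoryTheory _root_.CategoryTheory.Limits NumberField

namespace Literature.AlgebraicGeometry.ComplexMultiplication.CMWeights

open Literature.AlgebraicGeometry.ComplexMultiplication.Domination

open Literature.AlgebraicGeometry.Motives (AbelianVariety CMType)
open Literature.AlgebraicGeometry.HodgeTheory
open Literature.AlgebraicGeometry.Pohlmann1968
open Literature.AlgebraicGeometry.ComplexMultiplication (IsCMTypeRealisation)
open Literature.AlgebraicTopology.SingularHomology
open Literature.NumberTheory.ComplexMultiplication
open Literature.Barriers.HodgeConjecture (divisorClassesSpan)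

open scoped Classical Pointwise

variable {n : ℕ} {K : Fin n → Type} [∀ i, Field (K i)] [∀ i, NumberField (K i)] [∀ i, IsCMField (K i)]
variable {A : Fin n → AbelianVariety ℂ} {Φ : ∀ i, CMType (K i)} {ι : ∀ i, 𝓞 (K i) →+* End (A i)}
  {θ : ∀ i, K i →+* Module.End ℂ (complexBetti (A i).X 1)}

/-! ### §1 Divisor weights are algebraic -/

omit [∀ i, IsCMField (K i)] in
/-- `Σ_i [K_i : ℚ] = 2 · dim (⨁_i A_i)` for a family of realisations (`dim_ℂ H¹(A_i) = [K_i:ℚ] = 2 dim A_i`).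
 [cite: vanGeemen1994HodgeAV, 4.9 and Lemma 5.2] -/
theorem sum_finrank_eq_two_mul_dim (hA : ∀ i, IsCMTypeRealisation (Φ i) (A i) (ι i) (θ i)) :
    ∑ i, Module.finrank ℚ (K i) = 2 * (⨁ A).dim := by
  rw [AndreRiemann.dim_biproduct_fin, Finset.mul_sum]
  refine Finset.sum_congr rfl fun i _ => ?_
  rw [← (hA i).2.1, AbelianVariety.finrank_complexBetti_one]

omit [∀ i, IsCMField (K i)] in
/-- **A Weil section makes `(B, φ_S)` a pair of Weil type.**  For realisations of total dimension `2m` (`m ≥ 1`)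
and a Weil section `S ∈ pohlmannSetsAlg Φ m`, with the `d ≥ 1`, `a_i ∈ 𝓞_{K_i}` (`a_i² = -d`) of
`weightClassesAlg_le_weilClassesPlus_of_weilSection`: `φ_S = ⊕_i ι_i(a_i)` has `φ_S² = -d`, the weight line
`H^{2m}(B)_S` lies in the Weil plane `weilClassesOf B φ_S m d`, and `(B, φ_S)` is of Weil type `(m, d)` — the plane
contains the NON-ZERO `(m,m)` class `w_S` (Deligne–Milne Prop. 4.4 (⇒), `isWeilType_of_weilClass_ne_zero`).
[cite: Deligne1982HodgeCycles, §4 Prop. 4.4] [cite: vanGeemen1994HodgeAV, 4.9–4.10] -/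
theorem isWeilType_of_weilSection (hA : ∀ i, IsCMTypeRealisation (Φ i) (A i) (ι i) (θ i)) {m : ℕ}
    (hm : 0 < m) (hdim : (⨁ A).dim = 2 * m) {S : Finset ((i : Fin n) × (K i →+* ℂ))}
    (hS : S ∈ pohlmannSetsAlg Φ m) (hsec : ∀ x ∈ S, (starRingAut : ℂ ≃+* ℂ) • x ∉ S)
    (hfull : ∀ x : (i : Fin n) × (K i →+* ℂ), x ∈ S ∨ (starRingAut : ℂ ≃+* ℂ) • x ∈ S)
    (hW : ∀ τ : ℂ ≃+* ℂ, τ • S = S ∨ τ • S = (starRingAut : ℂ ≃+* ℂ) • S) :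
    ∃ (d : ℕ) (a : ∀ i, 𝓞 (K i)), 0 < d ∧
      (biproduct.map fun i => ι i (a i)) ≫ (biproduct.map fun i => ι i (a i)) = -(d • 𝟙 (⨁ A)) ∧
      weightClassesAlg A ι (2 * m) S ≤ weilClassesOf (⨁ A) (biproduct.map fun i => ι i (a i)) m d ∧
      IsWeilType (⨁ A) (biproduct.map fun i => ι i (a i)) m d := by
  have hS0 : S.Nonempty := by rw [← Finset.card_pos, hS.1]; omega
  obtain ⟨d, a, hd, -, hφ, hle, c, hc, hc0, hcH⟩ :=
    weightClassesAlg_le_weilClassesPlus_of_weilSection hA hS hS0 hsec hfull hW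
  have hle' : weightClassesAlg A ι (2 * m) S ≤ weilClassesOf (⨁ A) (biproduct.map fun i => ι i (a i)) m d :=
    hle.trans (weilClassesPlus_le_weilClassesOf _ _ m d)
  refine ⟨d, a, hd, hφ, hle', ?_⟩
  rw [hdim] at hcH
  exact isWeilType_of_weilClass_ne_zero hm hd hdim hφ (hle' hc) hc0 hcH

/-- **`B²(B) ⊗ ℂ ⊆ (D²(B) ⊗ ℂ) + span_ℂ {rational (2,2) Weil classes}` for a CM-product fourfold** — the CONCLUSION of
the named fact `MoonenZarhin1999_codimTwoHodgeClasses_abelianFourfold` (Moonen–Zarhin 1999 Thm. 0.1 with (1.4),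
(1.9): «`B²(X) = D²(X) + Σ W_k`») at `B = ⨁_i A_i`, `dim B = 4`, PROVED: a divisor weight lies in `D² ⊗ ℂ`; a Weil
section's line lies in the Weil plane of the Weil-type pair `(B, φ_S)`, which is the complex span of its rational
classes (`weilClassesOf_eq_span_isRationalClass`), all of type `(2,2)` (`IsWeilType.isOfHodgeType_of_mem_weilClassesOf`).
[cite: MoonenZarhin1999LowDim, Thm. 0.1 with (1.4) and (1.9)] [cite: vanGeemen1994HodgeAV, 4.9 and Lemma 5.2] -/
theorem moonenZarhin_codimTwo_biproduct_cm (hA : ∀ i, IsCMTypeRealisation (Φ i) (A i) (ι i) (θ i))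
    (h4 : (⨁ A).dim = 4) (c : complexBetti (⨁ A).X (2 * 2)) (hcQ : IsRationalClass c)
    (hcH : IsOfHodgeType (⨁ A).dim (⨁ A).X (2 * 2) 2 2 c) :
    c ∈ divisorClassesSpan (⨁ A).X (⨁ A).dim 2 ⊔
      Submodule.span ℂ {w : complexBetti (⨁ A).X (2 * 2) | ∃ (d : ℕ) (φ : (⨁ A) ⟶ (⨁ A)), 0 < d ∧
        φ ≫ φ = -(d • 𝟙 (⨁ A)) ∧ IsRationalClass w ∧ IsOfHodgeType (⨁ A).dim (⨁ A).X (2 * 2) 2 2 w ∧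
        w ∈ weilClassesOf (⨁ A) φ 2 d} := by
  have h8 : ∑ i, Module.finrank ℚ (K i) = 8 := by rw [sum_finrank_eq_two_mul_dim hA, h4]
  have hdim : (⨁ A).dim = 2 * 2 := h4
  refine (iSup₂_le fun S hS => ?_ :
    (⨆ S ∈ pohlmannSetsAlg Φ 2, weightClassesAlg A ι (2 * 2) S) ≤ _) (mem_iSup_weightClassesAlg hA hcQ hcH)
  rcases mem_pohlmannDivisorSetsAlg_two_or_weilSection h8 Φ hS with hD | ⟨hsec, hfull, hW⟩
  · refine le_trans ?_ le_sup_left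
    rw [divisorClassesSpan_biproduct_eq_iSup hA 2]
    exact le_iSup₂_of_le S hD le_rfl
  · obtain ⟨d, a, hd, hφ, hle, hWT⟩ := isWeilType_of_weilSection hA (by norm_num) hdim hS hsec hfull hW
    refine le_trans hle (le_trans ?_ le_sup_right)
    rw [weilClassesOf_eq_span_isRationalClass (by norm_num) hdim hd hφ]
    refine Submodule.span_mono ?_
    rintro w ⟨hwQ, hwW⟩
    refine ⟨d, _, hd, hφ, hwQ, ?_, hwW⟩
    rw [hdim]
    exact hWT.isOfHodgeType_of_mem_weilClassesOf hwW

end Literature.AlgebraicGeometry.ComplexMultiplication.CMWeights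

end

/-! ## Part 6: CMFivefoldsOfMarkman -/

noncomputable section

open _root_.CategoryTheory _root_.CategoryTheory.Limits NumberField

namespace Literature.AlgebraicGeometry.ComplexMultiplication.CMWeights

open Literature.AlgebraicGeometry.Motives Literature.AlgebraicGeometry.Motives.AbelianVariety
open Literature.AlgebraicGeometry.HodgeTheory
open Literature.AlgebraicGeometry.Pohlmann1968
open Literature.AlgebraicGeometry.ComplexMultiplication
open Literature.AlgebraicGeometry.Milne1999
open Literature.NumberTheory.ComplexMultiplication
open Literature.AlgebraicGeometry.ComplexMultiplication.Domination Literature.AlgebraicGeometry.ComplexMultiplication.AndreRiemann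
open _root_.AlgebraicGeometry (IsClosedImmersion)

open scoped Classical Pointwise

/-! ### §1 Pair rigidity for simple realisations (Shimura's Prop. 26) -/

section Rigid

variable {n : ℕ} {K : Fin n → Type} [∀ i, Field (K i)] [∀ i, NumberField (K i)] [∀ i, IsCMField (K i)]
variable {A : Fin n → AbelianVariety ℂ} {Φ : ∀ i, CMType (K i)} {ι : ∀ i, 𝓞 (K i) →+* End (A i)}
  {θ : ∀ i, K i →+* Module.End ℂ (complexBetti (A i).X 1)}

omit [∀ i, NumberField (K i)] [∀ i, IsCMField (K i)] in
/-- **A balanced pair is a complementary pair**: if `{x, y}` (`x ≠ y`) satisfies Pohlmann's Galois condition then,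
for every `τ ∈ Aut(ℂ)`, exactly one of `τ ∘ x`, `τ ∘ y` lies in the type. [cite: GaoUllmo2025, Thm. 3.1 (3.2)] -/
theorem comp_mem_iff_comp_not_mem_of_isGaloisBalancedAlg_pair (Φ : ∀ i, CMType (K i))
    {x y : (i : Fin n) × (K i →+* ℂ)} (hxy : x ≠ y) (hbal : IsGaloisBalancedAlg Φ ({x} ∪ ({y} : Finset _)))
    (τ : ℂ ≃+* ℂ) : (τ : ℂ →+* ℂ).comp x.2 ∈ (Φ x.1).1 ↔ (τ : ℂ →+* ℂ).comp y.2 ∉ (Φ y.1).1 := by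
  have h := hbal τ
  have hdisj : Disjoint ({x} : Finset ((i : Fin n) × (K i →+* ℂ))) {y} := Finset.disjoint_singleton.2 hxy
  rw [ncard_sep_union_of_disjoint hdisj (fun z => (τ : ℂ →+* ℂ).comp z.2 ∈ (Φ z.1).1),
    ncard_sep_union_of_disjoint hdisj (fun z => (τ : ℂ →+* ℂ).comp z.2 ∉ (Φ z.1).1),
    ncard_sep_singleton_mem, ncard_sep_singleton_mem, ncard_sep_singleton_not_mem,
    ncard_sep_singleton_not_mem] at h
  by_cases hx : (τ : ℂ →+* ℂ).comp x.2 ∈ (Φ x.1).1 <;> by_cases hy : (τ : ℂ →+* ℂ).comp y.2 ∈ (Φ y.1).1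
  · rw [if_pos hx, if_pos hy, if_pos hx, if_pos hy] at h; omega
  · exact ⟨fun _ => hy, fun _ => hx⟩
  · exact ⟨fun h' => (hx h').elim, fun h' => (h' hy).elim⟩
  · rw [if_neg hx, if_neg hy, if_neg hx, if_neg hy] at h; omega

/-- **Pair rigidity for families of SIMPLE realisations.**  If every `A_i` is a simple realisation of `(K_i; Φ_i)`,
then the only Galois-balanced pairs inside one block `Hom(K_i, ℂ)` are the conjugate pairs `{s, s̄}`: a balanced
pair `{s, t}` forces `τ ∘ s̄ ∈ Φ_i ⟺ τ ∘ s ∉ Φ_i ⟺ τ ∘ t ∈ Φ_i` for all `τ ∈ Aut(ℂ)` (`Φ_i` is a CM type and complex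
conjugation commutes with `Aut(ℂ)` on a CM field), and Shimura's Proposition 26 («simple ⟺ primitive»,
`isSimple_iff_primitive`) gives `t = s̄`. [cite: Shimura1998, §8.2 Prop. 26 (p. 63)] -/
theorem eq_conj_smul_of_isGaloisBalancedAlg_pair_of_isSimple
    (hA : ∀ i, IsCMTypeRealisation (Φ i) (A i) (ι i) (θ i)) (hs : ∀ i, (A i).IsSimple) :
    ∀ x y : (i : Fin n) × (K i →+* ℂ), x.1 = y.1 → x ≠ y →
      IsGaloisBalancedAlg Φ ({x} ∪ ({y} : Finset _)) → y = (starRingAut : ℂ ≃+* ℂ) • x := by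
  rintro ⟨i, s⟩ ⟨j, t⟩ hij hxy hbal
  dsimp only at hij
  subst hij
  have hone := comp_mem_iff_comp_not_mem_of_isGaloisBalancedAlg_pair Φ hxy hbal
  -- `s̄` and `t` have the same pattern
  have hpat : ∀ τ : ℂ ≃+* ℂ,
      (τ : ℂ →+* ℂ).comp (((starRingAut : ℂ ≃+* ℂ) : ℂ →+* ℂ).comp s) ∈ (Φ i).1 ↔
        (τ : ℂ →+* ℂ).comp t ∈ (Φ i).1 := by
    intro τ
    have hcomm := smul_conj_smul_comm τ (⟨i, s⟩ : (i : Fin n) × (K i →+* ℂ))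
    have hmem := conj_smul_mem_iff Φ (τ • (⟨i, s⟩ : (i : Fin n) × (K i →+* ℂ)))
    rw [← hcomm] at hmem
    exact hmem.trans (hone τ).not_left
  have hst := (isSimple_iff_primitive (hA i)).1 (hs i) _ _ hpat
  rw [smul_sigma_eq, hst]

end Rigid

/-! ### §2 CM abelian varieties are isogenous to biproducts of SIMPLE realisations -/

/-- Transport of atoms along isogenies through a product tree (the tree's `exists_isProductOf_isCMTyped_of_atoms`
with an arbitrary target predicate). [cite: MoonenZarhin1999LowDim, Thms. 0.1, 0.2] -/
theorem exists_isProductOf_of_atoms {R R' : AbelianVariety ℂ → Prop}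
    (hR : ∀ B : AbelianVariety ℂ, R B → ∃ B' : AbelianVariety ℂ, R' B' ∧ IsIsogenous B B')
    {P : AbelianVariety ℂ} (hP : IsProductOf R P) :
    ∃ P' : AbelianVariety ℂ, IsProductOf R' P' ∧ IsIsogenous P P' := by
  induction hP with
  | atom h =>
    obtain ⟨B', hB', hiso⟩ := hR _ h
    exact ⟨B', .atom hB', hiso⟩
  | prod _ _ ih₁ ih₂ =>
    obtain ⟨P₁, h₁, i₁⟩ := ih₁
    obtain ⟨P₂, h₂, i₂⟩ := ih₂
    exact ⟨P₁.prod P₂, .prod h₁ h₂, i₁.prod i₂⟩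

/-- **Every complex abelian variety of CM type of positive dimension is isogenous to a finite product of SIMPLE
CM-typed abelian varieties**: the hereditary Poincaré decomposition into simple abelian subvarieties of positive
dimension (`exists_isogeny_from_productOf_simple_pos_of_hereditary`), CM type at simple subvarieties
(`isOfCMType_of_isSimple_of_isClosedImmersion`), Deligne's «simple of CM type ⟹ isogenous to a CM-typed one»
(`exists_isCMTyped_isIsogenous_of_isSimple`, unconditional), and isogeny invariance of simplicity
(`isSimple_iff_of_isIsogenous`). [cite: MumfordAV1970, §19 Thm. 1 Cor. 1 (pp. 173–174)]
[cite: Deligne1982HodgeCycles, I Prop. 5.1 and §5 (p. 37)] [cite: Shimura1998, §5.1 Props. 3–6, §7.1 Prop. 7] -/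
theorem exists_isProductOf_simple_cmTyped (A : AbelianVariety ℂ) (hA0 : 0 < A.dim) (hA : IsOfCMType A) :
    ∃ B : AbelianVariety ℂ, IsProductOf (fun B => IsCMTyped B ∧ B.IsSimple) B ∧ IsIsogenous A B := by
  obtain ⟨P, g, hP, hg⟩ :=
    exists_isogeny_from_productOf_simple_pos_of_hereditary
      (fun B ↦ ∃ f : B ⟶ A, IsClosedImmersion (AbelianVariety.Hom.toSchemeHom f))
      (fun B C f hf ⟨i, hi⟩ ↦ ⟨f ≫ i, by
        haveI := hf; haveI := hi
        change IsClosedImmersion (AbelianVariety.Hom.toSchemeHom f ≫ AbelianVariety.Hom.toSchemeHom i)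
        infer_instance⟩)
      A ⟨𝟙 A, by change IsClosedImmersion (𝟙 A.X.left); infer_instance⟩ hA0
  obtain ⟨P', hP', hPP'⟩ := exists_isProductOf_of_atoms (R' := fun B => IsCMTyped B ∧ B.IsSimple)
    (fun B ⟨hsB, hB0, i, hi⟩ ↦ by
      haveI := hi
      obtain ⟨B', hB', hBB'⟩ :=
        exists_isCMTyped_isIsogenous_of_isSimple B hsB hB0 (isOfCMType_of_isSimple_of_isClosedImmersion hA hsB i)
      exact ⟨B', ⟨hB', (isSimple_iff_of_isIsogenous hBB').1 hsB⟩, hBB'⟩) hP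
  exact ⟨P', hP', (IsIsogenous.symm_of_charZero (A := P) (B := A) ⟨g, hg⟩).trans hPP'⟩

/-- **A finite product of SIMPLE CM-typed abelian varieties is dominated by a biproduct of SIMPLE realisations of the
same total dimension** (the proof of `exists_biproduct_family_of_isProductOf`, carrying simplicity along).
[cite: MumfordAV1970, §19 Thm. 1 and p. 169] -/
theorem exists_simple_biproduct_family_of_isProductOf {B : AbelianVariety ℂ}
    (hB : IsProductOf (fun B => IsCMTyped B ∧ B.IsSimple) B) :
    ∃ (n : ℕ) (K : Fin n → Type) (_ : ∀ i, Field (K i)) (_ : ∀ i, NumberField (K i)) (_ : ∀ i, IsCMField (K i))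
      (C : Fin n → AbelianVariety ℂ) (Φ : ∀ i, CMType (K i)) (ι : ∀ i, 𝓞 (K i) →+* End (C i))
      (θ : ∀ i, K i →+* Module.End ℂ (complexBetti (C i).X 1)),
      (∀ i, IsCMTypeRealisation (Φ i) (C i) (ι i) (θ i)) ∧ (∀ i, (C i).IsSimple) ∧ AVDominatedBy B (⨁ C) ∧
        (⨁ C).dim = B.dim := by
  classical
  induction hB with
  | @atom B hBt =>
    obtain ⟨hBt, hsB⟩ := hBt
    obtain ⟨Φ, B, ι, θ, h⟩ := hBt
    rename_i K _ _ _
    refine ⟨1, fun _ => K, fun _ => inferInstance, fun _ => inferInstance, fun _ => inferInstance, fun _ => B,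
      fun _ => Φ, fun _ => ι, fun _ => θ, fun _ => h, fun _ => hsB, avDominatedBy_biproduct_single B, ?_⟩
    rw [dim_biproduct_fin]
    simp
  | @prod B₁ B₂ _ _ ih₁ ih₂ =>
    obtain ⟨n₁, K₁, iF₁, iN₁, iC₁, C₁, Φ₁, ι₁, θ₁, hC₁, hs₁, hd₁, hdim₁⟩ := ih₁
    obtain ⟨n₂, K₂, iF₂, iN₂, iC₂, C₂, Φ₂, ι₂, θ₂, hC₂, hs₂, hd₂, hdim₂⟩ := ih₂
    let K : Fin n₁ ⊕ Fin n₂ → Type := fun j => match j with | Sum.inl j => K₁ j | Sum.inr j => K₂ j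
    letI iF : ∀ j, Field (K j) := fun j => match j with | Sum.inl j => iF₁ j | Sum.inr j => iF₂ j
    letI iN : ∀ j, NumberField (K j) := fun j => match j with | Sum.inl j => iN₁ j | Sum.inr j => iN₂ j
    have iC : ∀ j, IsCMField (K j) := fun j => match j with | Sum.inl j => iC₁ j | Sum.inr j => iC₂ j
    let Φ : ∀ j, CMType (K j) := fun j => match j with | Sum.inl j => Φ₁ j | Sum.inr j => Φ₂ j
    let ι : ∀ j, 𝓞 (K j) →+* End (sumFam C₁ C₂ j) := fun j => match j with | Sum.inl j => ι₁ j | Sum.inr j => ι₂ j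
    let θ : ∀ j, K j →+* Module.End ℂ (complexBetti (sumFam C₁ C₂ j).X 1) :=
      fun j => match j with | Sum.inl j => θ₁ j | Sum.inr j => θ₂ j
    have hC : ∀ j, IsCMTypeRealisation (Φ j) (sumFam C₁ C₂ j) (ι j) (θ j) :=
      fun j => match j with | Sum.inl j => hC₁ j | Sum.inr j => hC₂ j
    have hS : ∀ j, (sumFam C₁ C₂ j).IsSimple := fun j => match j with | Sum.inl j => hs₁ j | Sum.inr j => hs₂ j
    let e : Fin (n₁ + n₂) ≃ Fin n₁ ⊕ Fin n₂ := finSumFinEquiv.symm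
    refine ⟨n₁ + n₂, fun i => K (e i), fun i => iF (e i), fun i => iN (e i), fun i => iC (e i),
      fun i => sumFam C₁ C₂ (e i), fun i => Φ (e i), fun i => ι (e i), fun i => θ (e i), fun i => hC (e i),
      fun i => hS (e i), avDominatedBy_biproduct_reindex e (avDominatedBy_prod_of_biproduct hd₁ hd₂), ?_⟩
    rw [dim_biproduct_fin, dim_prod, ← hdim₁, ← hdim₂, dim_biproduct_fin, dim_biproduct_fin]
    rw [show (∑ i : Fin (n₁ + n₂), (sumFam C₁ C₂ (e i)).dim) = ∑ j : Fin n₁ ⊕ Fin n₂, (sumFam C₁ C₂ j).dim from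
      Fintype.sum_equiv e _ _ fun _ => rfl, Fintype.sum_sum_type]

end Literature.AlgebraicGeometry.ComplexMultiplication.CMWeights

end

/-! ## Part 7: CMProductFivefoldsOfMarkman -/

noncomputable section

open _root_.CategoryTheory _root_.CategoryTheory.Limits NumberField

namespace Literature.AlgebraicGeometry.ComplexMultiplication.CMWeights

open Literature.AlgebraicGeometry.Motives (AbelianVariety CMType)
open Literature.AlgebraicGeometry.HodgeTheory
open Literature.AlgebraicGeometry.Pohlmann1968
open Literature.AlgebraicTopology.SingularHomology
open Literature.NumberTheory.ComplexMultiplication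

open scoped Classical Pointwise

/-! ### §1 Bookkeeping along a coordinate embedding `σ_e (j, s) = (e j, s)` -/

section Bookkeeping

variable {m n : ℕ} {K : Fin n → Type} [∀ i, Field (K i)]

/-- `σ_e` commutes with the action of `Aut(ℂ)`: `τ • σ_e(S'') = σ_e(τ • S'')`. [cite: MoonenZarhin1999LowDim, Thm. 0.2] -/
theorem smul_finset_map_sigma (e : Fin m → Fin n) (he : Function.Injective e) (τ : ℂ ≃+* ℂ)
    (S'' : Finset ((j : Fin m) × (K (e j) →+* ℂ))) :
    τ • S''.map ⟨_, sigma_map_injective e he⟩ = (τ • S'').map ⟨_, sigma_map_injective e he⟩ := by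
  ext x
  simp only [Finset.mem_smul_finset, Finset.mem_map, Function.Embedding.coeFn_mk]
  constructor
  · rintro ⟨y, ⟨z, hz, rfl⟩, rfl⟩
    exact ⟨τ • z, ⟨z, hz, rfl⟩, rfl⟩
  · rintro ⟨y, ⟨z, hz, rfl⟩, rfl⟩
    exact ⟨⟨e z.1, z.2⟩, ⟨z, hz, rfl⟩, rfl⟩

/-- Pohlmann's condition descends along `σ_e`: if `σ_e(S'')` is balanced for `(Φ_i)_i`, then `S''` is balanced for
`(Φ_{e j})_j` (the counts correspond under the injective `σ_e`). [cite: Gordon1999HodgeAVSurvey, 9.2.2] -/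
theorem isGaloisBalancedAlg_comap (e : Fin m → Fin n) (he : Function.Injective e) (Φ : ∀ i, CMType (K i))
    {S'' : Finset ((j : Fin m) × (K (e j) →+* ℂ))} (h : IsGaloisBalancedAlg Φ (S''.map ⟨_, sigma_map_injective e he⟩)) :
    IsGaloisBalancedAlg (fun j => Φ (e j)) S'' := by
  have count : ∀ (Q : ∀ i, (K i →+* ℂ) → Prop),
      {x | x ∈ S''.map ⟨_, sigma_map_injective e he⟩ ∧ Q x.1 x.2}.ncard = {x | x ∈ S'' ∧ Q (e x.1) x.2}.ncard := by
    intro Q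
    rw [show {x | x ∈ S''.map ⟨_, sigma_map_injective e he⟩ ∧ Q x.1 x.2} =
        (fun x : (j : Fin m) × (K (e j) →+* ℂ) => (⟨e x.1, x.2⟩ : (i : Fin n) × (K i →+* ℂ))) ''
          {x | x ∈ S'' ∧ Q (e x.1) x.2} by
      ext x
      simp only [Set.mem_setOf_eq, Finset.mem_map, Function.Embedding.coeFn_mk, Set.mem_image]
      constructor
      · rintro ⟨⟨y, hy, rfl⟩, hQ⟩; exact ⟨y, ⟨hy, hQ⟩, rfl⟩
      · rintro ⟨y, ⟨hy, hQ⟩, rfl⟩; exact ⟨⟨y, hy, rfl⟩, hQ⟩,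
      Set.ncard_image_of_injective _ (sigma_map_injective e he)]
  intro τ
  have h1 := h τ
  rw [count (fun i s => (τ : ℂ →+* ℂ).comp s ∈ (Φ i).1), count (fun i s => (τ : ℂ →+* ℂ).comp s ∉ (Φ i).1)] at h1
  exact h1

end Bookkeeping

end Literature.AlgebraicGeometry.ComplexMultiplication.CMWeights

end
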